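import Summits.BirchSwinnertonDyer.BirchSwinnertonDyer.Theorems.ClassRecordThreeEulerHalvesAtThreeCartanTorusCubeCutFrame
import HarnessLib

/-!
# Crux 19109 `EulerHalvesAtThree` ∕ 23422 line `cartan` v8′, stub (F2a): the TORUS-CUBE CUT of S-K1′ — file 2/3: the TORUS CARDINALITIES (proved)
# `|T_s| = (q − 1)²` and `|T_C| = (q − 1)(q + 1)` in `GL₂(𝔽_q)`

Seat `bsd-idea-10` g11 (planner-bsd-idea-10-g11-0, D-0145 ideator; `--supports stmt-BirchSwinnertonDyer-19109 --as helper`). CONTENT: two of the three clauses of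
input (T) of the torus-cube cut, PROVED: the split torus `splitTorus q` (invertible matrices with zero off-diagonal entries) is the image of the diagonal embedding
`(𝔽_q^×)² ↪ GL₂(𝔽_q)`, so `|T_s| = (q−1)²` (`splitTorus_card`); and for `η` WITHOUT RATIONAL EIGENVALUE (`¬ HasRatEigenvalue η`) the centraliser `nonsplitTorus η` is
`{a·1 + t·η : (a,t) ≠ (0,0)}` — every matrix commuting with `η` is `a·1 + t·η` (first-row determination, using `η 0 1 ≠ 0`), and `a·1 + t·η` is invertible unless
`(a,t) = 0` because `det(a·1 + t·η) = a² + a t·tr η + t²·det η` has no non-trivial zero (that would be a rational eigenvalue `−a/t`) — so `|T_C| = q² − 1 = (q−1)(q+1)`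
(`nonsplitTorus_card`). The remaining clause of (T) (the cubes `T_C³` have index 3, i.e. `T_C ≅ 𝔽_{q²}^×` is cyclic and `3 ∣ q² − 1`) stays an input in file 3/3.
HONEST FRAMING: elementary finite-field counting; nothing about any curve, `L`-value or period; S-K1′ is NOT proved; no summit statement, no route item and no
registered stub is proved; BSD is proved for no curve. [folklore; background: cite: Bump1997, §4.1]
-/

namespace Summit.BirchSwinnertonDyer.BirchSwinnertonDyer.Theorems.CartanTorusCubeCut

open Summit.BirchSwinnertonDyer.BirchSwinnertonDyer.Theorems.CartanDegree

set_option linter.dupNamespace false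
set_option autoImplicit false

noncomputable section

variable {q : ℕ} [Fact q.Prime]

/-! ### Towards (T): the split torus has `(q − 1)²` elements (proved; the non-split clauses of (T) remain inputs) -/

/-- the diagonal embedding `(𝔽_q^×)^2 → GL₂(𝔽_q)`. -/
def diagGL (u : Fin 2 → (ZMod q)ˣ) : G q :=
  Units.map (Matrix.diagonalRingHom (Fin 2) (ZMod q)).toMonoidHom (MulEquiv.piUnits.symm u)

/-- the matrix of `diagGL u` is the diagonal matrix of `u`. -/
theorem diagGL_coe (u : Fin 2 → (ZMod q)ˣ) :
    ((diagGL u : G q) : Mat q) = Matrix.diagonal (fun i => (u i : ZMod q)) := by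
  rfl

/-- `diagGL` is injective. -/
theorem diagGL_injective : Function.Injective (diagGL (q := q)) := by
  intro u v h
  have h' := congrArg (fun g : G q => (g : Mat q)) h
  simp only [diagGL_coe] at h'
  funext i
  have := congrFun (congrFun h' i) i
  simp [Matrix.diagonal_apply_eq] at this
  exact Units.ext this

/-- the split torus is the image of the diagonal embedding (an invertible matrix with zero off-diagonal entries has unit
diagonal entries). -/
theorem splitTorus_eq_image :
    splitTorus q = Finset.univ.image (diagGL (q := q)) := by
  ext g
  simp only [splitTorus, Finset.mem_filter, Finset.mem_univ, true_and, Finset.mem_image]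
  constructor
  · rintro ⟨h01, h10⟩
    have hmul : (g : Mat q) * ((g⁻¹ : G q) : Mat q) = 1 := by
      rw [← Units.val_mul, mul_inv_cancel, Units.val_one]
    have e00 : (g : Mat q) 0 0 * ((g⁻¹ : G q) : Mat q) 0 0 = 1 := by
      have := congrFun (congrFun hmul 0) 0
      rw [Matrix.mul_apply, Fin.sum_univ_two, h01, zero_mul, add_zero, Matrix.one_apply_eq] at this
      exact this
    have e11 : (g : Mat q) 1 1 * ((g⁻¹ : G q) : Mat q) 1 1 = 1 := by
      have := congrFun (congrFun hmul 1) 1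
      rw [Matrix.mul_apply, Fin.sum_univ_two, h10, zero_mul, zero_add, Matrix.one_apply_eq] at this
      exact this
    refine ⟨![Units.mkOfMulEqOne _ _ e00, Units.mkOfMulEqOne _ _ e11], ?_⟩
    apply Units.ext
    rw [diagGL_coe]
    ext i j
    fin_cases i <;> fin_cases j <;> simp [Matrix.diagonal, h01, h10]
  · rintro ⟨u, rfl⟩
    rw [diagGL_coe]
    simp [Matrix.diagonal]

/-- **(T), first clause, PROVED**: `|T_s| = (q − 1)²`. -/
theorem splitTorus_card : (splitTorus q).card = (q - 1) ^ 2 := by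
  rw [splitTorus_eq_image, Finset.card_image_of_injective _ diagGL_injective, Finset.card_univ,
    Fintype.card_fun, ZMod.card_units, Fintype.card_fin]

/-! ### The non-split torus has `(q − 1)(q + 1)` elements -/

/-- a matrix without rational eigenvalue has non-zero upper-right entry. -/
theorem entry01_ne_zero {η : Mat q} (hη : ¬ HasRatEigenvalue η) : η 0 1 ≠ 0 := by
  intro h
  apply hη
  refine ⟨η 1 1, ?_⟩
  rw [Matrix.det_fin_two, Matrix.trace_fin_two, h]
  ring

/-- the elements `a·1 + t·η` of `𝔽_q[η]`. -/
def lin (η : Mat q) (p : ZMod q × ZMod q) : Mat q := p.1 • (1 : Mat q) + p.2 • η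

/-- `a·1 + t·η` commutes with `η`. -/
theorem lin_comm (η : Mat q) (p : ZMod q × ZMod q) : lin η p * η = η * lin η p := by
  simp only [lin, add_mul, mul_add, smul_mul_assoc, mul_smul_comm, one_mul, mul_one]

/-- `det(a·1 + t·η) = a² + a t·tr η + t²·det η`. -/
theorem det_lin (η : Mat q) (p : ZMod q × ZMod q) :
    (lin η p).det = p.1 * p.1 + p.1 * p.2 * η.trace + p.2 * p.2 * η.det := by
  simp only [lin, Matrix.det_fin_two, Matrix.trace_fin_two, Matrix.add_apply, Matrix.smul_apply,
    Matrix.one_apply_eq, Matrix.one_apply_ne (by decide : (0 : Fin 2) ≠ 1),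
    Matrix.one_apply_ne (by decide : (1 : Fin 2) ≠ 0), smul_eq_mul]
  ring

/-- if `η` has no rational eigenvalue, `a·1 + t·η` is invertible unless `(a,t) = 0` (`𝔽_q[η]` is a field). -/
theorem det_lin_ne_zero {η : Mat q} (hη : ¬ HasRatEigenvalue η) {p : ZMod q × ZMod q} (hp : p ≠ 0) :
    (lin η p).det ≠ 0 := by
  intro h
  rw [det_lin] at h
  by_cases ht : p.2 = 0
  · have h1 : p.1 * p.1 = 0 := by simpa [ht] using h
    have : p.1 = 0 := by
      rcases mul_eq_zero.1 h1 with h0 | h0 <;> exact h0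
    exact hp (Prod.ext this ht)
  · apply hη
    refine ⟨-(p.1 * p.2⁻¹), ?_⟩
    have : p.2⁻¹ * p.2 = 1 := inv_mul_cancel₀ ht
    have key : (p.1 * p.1 + p.1 * p.2 * η.trace + p.2 * p.2 * η.det) * (p.2⁻¹ * p.2⁻¹) = 0 := by
      rw [h, zero_mul]
    have e : (-(p.1 * p.2⁻¹)) * (-(p.1 * p.2⁻¹)) + η.det - η.trace * (-(p.1 * p.2⁻¹))
        = (p.1 * p.1 + p.1 * p.2 * η.trace + p.2 * p.2 * η.det) * (p.2⁻¹ * p.2⁻¹) := by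
      field_simp
      ring
    have := sub_eq_zero.1 (e.trans key)
    linear_combination this

/-- the parametrisation `(a,t) ↦ a·1 + t·η` of the non-split torus (off `(0,0)`). -/
def linGL (η : Mat q) (hη : ¬ HasRatEigenvalue η) (p : ZMod q × ZMod q) : G q :=
  if hp : p = 0 then 1 else Matrix.GeneralLinearGroup.mkOfDetNeZero (lin η p) (det_lin_ne_zero hη hp)

/-- the matrix of `linGL η hη p` is `lin η p` for `p ≠ 0`. -/
theorem linGL_coe {η : Mat q} (hη : ¬ HasRatEigenvalue η) {p : ZMod q × ZMod q} (hp : p ≠ 0) :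
    ((linGL η hη p : G q) : Mat q) = lin η p := by
  simp [linGL, hp]

/-- `(a,t) ↦ a·1 + t·η` is injective (`1, η` are linearly independent as `η 0 1 ≠ 0`). -/
theorem lin_injective {η : Mat q} (hη : ¬ HasRatEigenvalue η) : Function.Injective (lin η) := by
  intro p p' h
  have h01 := congrFun (congrFun h 0) 1
  have h00 := congrFun (congrFun h 0) 0
  simp only [lin, Matrix.add_apply, Matrix.smul_apply, Matrix.one_apply_eq,
    Matrix.one_apply_ne (by decide : (0 : Fin 2) ≠ 1), smul_eq_mul, mul_zero, zero_add, mul_one] at h01 h00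
  have hf := entry01_ne_zero hη
  have h2 : p.2 = p'.2 := mul_right_cancel₀ hf h01
  have h1 : p.1 = p'.1 := by rw [h2] at h00; exact add_right_cancel h00
  exact Prod.ext h1 h2

/-- the non-split torus (centraliser of `η` in `GL₂(𝔽_q)`) is `{a·1 + t·η : (a,t) ≠ 0}`: a matrix commuting with `η` is determined by its
first row through the commutation relations, and is `a·1 + t·η`. -/
theorem nonsplitTorus_eq_image {η : Mat q} (hη : ¬ HasRatEigenvalue η) :
    nonsplitTorus η = ((Finset.univ : Finset (ZMod q × ZMod q)).erase 0).image (linGL η hη) := by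
  ext g
  simp only [nonsplitTorus, Finset.mem_filter, Finset.mem_univ, true_and, Finset.mem_image,
    Finset.mem_erase, ne_eq, and_true]
  have hf := entry01_ne_zero hη
  constructor
  · intro hg
    -- g = a·1 + t·η with t = g01 / η01, a = g00 - t η00
    obtain ⟨t, hg01⟩ : ∃ t : ZMod q, (g : Mat q) 0 1 = t * η 0 1 :=
      ⟨(g : Mat q) 0 1 * (η 0 1)⁻¹, by rw [mul_assoc, inv_mul_cancel₀ hf, mul_one]⟩
    obtain ⟨a, hg00⟩ : ∃ a : ZMod q, (g : Mat q) 0 0 = a + t * η 0 0 :=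
      ⟨(g : Mat q) 0 0 - t * η 0 0, by ring⟩
    have e00 := congrFun (congrFun hg 0) 0
    have e01 := congrFun (congrFun hg 0) 1
    simp only [Matrix.mul_apply, Fin.sum_univ_two] at e00 e01
    have hg10 : (g : Mat q) 1 0 = t * η 1 0 := by
      have h1 : η 0 1 * ((g : Mat q) 1 0 - t * η 1 0) = 0 := by
        linear_combination (-1 : ZMod q) * e00 + η 1 0 * hg01
      rcases mul_eq_zero.1 h1 with h | h
      · exact absurd h hf
      · exact sub_eq_zero.1 h
    have hg11 : (g : Mat q) 1 1 = a + t * η 1 1 := by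
      have h1 : η 0 1 * ((g : Mat q) 1 1 - (a + t * η 1 1)) = 0 := by
        linear_combination (-1 : ZMod q) * e01 + (η 1 1 - η 0 0) * hg01 + η 0 1 * hg00
      rcases mul_eq_zero.1 h1 with h | h
      · exact absurd h hf
      · exact sub_eq_zero.1 h
    have hp : (a, t) ≠ (0 : ZMod q × ZMod q) := by
      intro h0
      have ha0 : a = 0 := congrArg Prod.fst h0
      have ht0 : t = 0 := congrArg Prod.snd h0
      have hdet : ((g : Mat q)).det = 0 := by
        rw [Matrix.det_fin_two, hg00, hg01, ha0, ht0]; ring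
      have hu : IsUnit ((g : Mat q)).det := by
        rw [← Matrix.isUnit_iff_isUnit_det]; exact Units.isUnit g
      exact not_isUnit_zero (hdet ▸ hu)
    refine ⟨(a, t), hp, ?_⟩
    apply Units.ext
    rw [linGL_coe hη hp]
    ext i j
    fin_cases i <;> fin_cases j <;>
      simp [lin, hg00, hg01, hg10, hg11]
  · rintro ⟨p, hp, rfl⟩
    rw [linGL_coe hη hp]
    exact lin_comm η p

/-- **(T), second clause, PROVED**: `|T_C| = q² − 1 = (q − 1)(q + 1)` for `η` without rational eigenvalue. -/
theorem nonsplitTorus_card {η : Mat q} (hη : ¬ HasRatEigenvalue η) :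
    (nonsplitTorus η).card = (q - 1) * (q + 1) := by
  rw [nonsplitTorus_eq_image hη, Finset.card_image_of_injOn, Finset.card_erase_of_mem (Finset.mem_univ _),
    Finset.card_univ, Fintype.card_prod, ZMod.card]
  · have hq : 1 ≤ q := (Fact.out : q.Prime).one_le
    -- q*q - 1 = (q-1)*(q+1)
    rcases Nat.exists_eq_add_of_le hq with ⟨k, rfl⟩
    simp; ring_nf; omega
  · intro p hp p' hp' h
    simp only [Finset.coe_erase, Set.mem_sdiff, Finset.mem_coe, Finset.mem_univ, Set.mem_singleton_iff,
      true_and] at hp hp'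
    have := congrArg (fun g : G q => (g : Mat q)) h
    simp only [linGL_coe hη hp, linGL_coe hη hp'] at this
    exact lin_injective hη this

end

end Summit.BirchSwinnertonDyer.BirchSwinnertonDyer.Theorems.CartanTorusCubeCut
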